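import Summits.Ventures.PercRepro.S1ChainSkewCapSharp

/-!
# PercRepro — A POINT ON A LINE OF A SKEW UNION CARRIES AT MOST TWO FOUR-CIRCUITS (p2, gen 24; SUBCLAIM-S1 §6.9 (ix))

If the outside point `z` lies in the closure of two points `a, b` of the skew union `U` on different triangles,
its principal closed trace is contained in `{a, b}` (the hull of `{a, b}` is `{a, b}` itself), so every four-circuit
through `z` inside `U ∪ {z}` meets `F_z` in one point and is determined by it: at most `|F_z| ≤ 2` of them — the
profile `(0, 2)` of §6.9 (vi): `{z, a} ∪ (T_b ∖ b)` and `{z, b} ∪ (T_a ∖ a)`. This is the count for the points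
`x₂` (on the line `a x₁`) and `w` (on the line `bc`) of the four-skew configurations of `(10, 7)`, once the skew
union is allowed coloop summands.

* **`ncard_fourCircuits_through_le_two_of_mem_closure_pair`**.
Axioms: standard.
-/

open scoped Matroid

namespace PercRepro

namespace S1

open Set

variable {α : Type}

/-- **A POINT ON A LINE CARRIES AT MOST TWO FOUR-CIRCUITS**: `z ∉ U` with `z ∈ cl{a, b}`, `a, b ∈ U` on
different triangles of the skew union — at most two four-circuits through `z` lie inside `U ∪ {z}`. -/
theorem ncard_fourCircuits_through_le_two_of_mem_closure_pair (M : Matroid α) [M.Finite] (𝒯 : Finset (Set α))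
    (h𝒯 : ∀ C ∈ 𝒯, M.IsCircuit C ∧ C.ncard = 3) (hskew : M.eRk (⋃ C ∈ 𝒯, C) = 2 * 𝒯.card)
    {z : α} (hzE : z ∈ M.E) (hzU : z ∉ ⋃ C ∈ 𝒯, C) {a b : α} (ha : a ∈ ⋃ C ∈ 𝒯, C) (hb : b ∈ ⋃ C ∈ 𝒯, C)
    (hab : ∀ T ∈ 𝒯, a ∈ T → b ∈ T → False) (hz : z ∈ M.closure {a, b}) :
    {C : Set α | M.IsCircuit C ∧ C.ncard = 4 ∧ z ∈ C ∧ C ⊆ insert z (⋃ C' ∈ 𝒯, C')}.ncard ≤ 2 := by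
  classical
  have hUE := biUnion_subset_ground M 𝒯 h𝒯
  have hzcl : z ∈ M.closure (⋃ C ∈ 𝒯, C) :=
    M.closure_subset_closure (Set.insert_subset ha (Set.singleton_subset_iff.2 hb)) hz
  obtain ⟨F, hFU, hFcl, hzF, hFmin⟩ := exists_principal_closedTrace M 𝒯 h𝒯 hskew hzE hzcl
  have hUfin : (⋃ C ∈ 𝒯, C).Finite := M.ground_finite.subset hUE
  have hFfin : F.Finite := hUfin.subset hFU
  have hzF' : z ∉ F := fun h => hzU (hFU h)
  -- `F ⊆ hull {a, b} = {a, b}`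
  have habU : ({a, b} : Set α) ⊆ ⋃ C ∈ 𝒯, C := Set.insert_subset ha (Set.singleton_subset_iff.2 hb)
  have hFab : F ⊆ ({a, b} : Set α) := by
    have h := (mem_closure_iff_principal_subset_skewHull M 𝒯 h𝒯 hskew hzF hFmin habU).1 hz
    intro w hw
    have := h hw
    rw [mem_skewHull_iff] at this
    rcases this with h' | ⟨T, hT, hwT, h2⟩
    · exact h'
    · exfalso
      -- a triangle meeting `{a, b}` twice would contain both
      have hTfin : T.Finite := M.ground_finite.subset (h𝒯 T hT).1.subset_ground
      have hsub : ({a, b} : Set α) ∩ T ⊆ {a, b} := Set.inter_subset_left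
      have hpair2 : ({a, b} : Set α).ncard ≤ 2 := by
        calc ({a, b} : Set α).ncard ≤ ({b} : Set α).ncard + 1 := Set.ncard_insert_le a {b}
          _ = 2 := by rw [Set.ncard_singleton]
      have hcard : (({a, b} : Set α) ∩ T).ncard ≤ 2 :=
        (Set.ncard_le_ncard hsub (Set.toFinite _)).trans hpair2
      have heq : ({a, b} : Set α) ∩ T = {a, b} :=
        Set.eq_of_subset_of_ncard_le hsub (by omega) (Set.toFinite _)
      have haT : a ∈ T := ((Set.ext_iff.1 heq a).2 (Set.mem_insert a {b})).2
      have hbT : b ∈ T := ((Set.ext_iff.1 heq b).2 (Set.mem_insert_of_mem a rfl)).2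
      exact hab T hT haT hbT
  have hpair2 : ({a, b} : Set α).ncard ≤ 2 := by
    calc ({a, b} : Set α).ncard ≤ ({b} : Set α).ncard + 1 := Set.ncard_insert_le a {b}
      _ = 2 := by rw [Set.ncard_singleton]
  have hF2 : F.ncard ≤ 2 := (Set.ncard_le_ncard hFab (Set.toFinite _)).trans hpair2
  -- the circuits inject into the subsets of `F` of size `1` or `3`; size `3` is impossible
  set 𝒞 := {C : Set α | M.IsCircuit C ∧ C.ncard = 4 ∧ z ∈ C ∧ C ⊆ insert z (⋃ C' ∈ 𝒯, C')} with h𝒞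
  have hmem : ∀ C ∈ 𝒞, (C \ {z}) ⊆ ⋃ C' ∈ 𝒯, C' ∧ (C \ {z}).ncard = 3 ∧ M.IsCircuit (insert z (C \ {z})) ∧
      C ∩ F = (C \ {z}) ∩ F := by
    intro C hC
    obtain ⟨hcirc, h4, hzC, hsub⟩ := hC
    refine ⟨?_, ?_, ?_, ?_⟩
    · rintro x ⟨hxC, hxz⟩
      rcases hsub hxC with h | h
      · exact absurd h hxz
      · exact h
    · rw [Set.ncard_sdiff_singleton_of_mem hzC, h4]
    · rwa [Set.insert_sdiff_singleton, Set.insert_eq_of_mem hzC]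
    · ext x; simp only [Set.mem_inter_iff, Set.mem_sdiff, Set.mem_singleton_iff]
      constructor
      · rintro ⟨hxC, hxF⟩; exact ⟨⟨hxC, fun h => hzF' (h ▸ hxF)⟩, hxF⟩
      · rintro ⟨⟨hxC, -⟩, hxF⟩; exact ⟨hxC, hxF⟩
  have hinj : Set.InjOn (fun C => C ∩ F) 𝒞 := by
    intro C hC C' hC' heq
    obtain ⟨hB, -, hcirc, hCF⟩ := hmem C hC
    obtain ⟨hB', -, hcirc', hCF'⟩ := hmem C' hC'
    simp only at heq
    rw [hCF, hCF'] at heq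
    have := eq_of_inter_principal_eq M 𝒯 h𝒯 hskew hzU hFU hFcl hzF hFmin hB hcirc hB' hcirc' heq
    have hzC : z ∈ C := hC.2.2.1
    have hzC' : z ∈ C' := hC'.2.2.1
    calc C = insert z (C \ {z}) := by rw [Set.insert_sdiff_singleton, Set.insert_eq_of_mem hzC]
      _ = insert z (C' \ {z}) := by rw [this]
      _ = C' := by rw [Set.insert_sdiff_singleton, Set.insert_eq_of_mem hzC']
  set 𝒳₁ := {X : Set α | X ⊆ F ∧ X.ncard = 1} with h𝒳₁
  have h𝒳₁fin : 𝒳₁.Finite := hFfin.finite_subsets.subset (fun X hX => hX.1)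
  have hc1 : 𝒳₁.ncard = F.ncard.choose 1 := ncard_subsets_eq_choose F hFfin 1
  have hle : 𝒞.ncard ≤ 𝒳₁.ncard := by
    refine Set.ncard_le_ncard_of_injOn (fun C => C ∩ F) (fun C hC => ?_) hinj h𝒳₁fin
    obtain ⟨hB, hB3, hcirc, hCF⟩ := hmem C hC
    refine ⟨Set.inter_subset_right, ?_⟩
    rcases ncard_inter_principal_cases M 𝒯 h𝒯 hskew hzU hFU hFcl hzF hFmin hB hcirc hB3 with h3 | ⟨h1, -⟩
    · exfalso
      have := Set.ncard_le_ncard (Set.inter_subset_right : (C \ {z}) ∩ F ⊆ F) hFfin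
      omega
    · rw [hCF]; exact h1
  rw [hc1, Nat.choose_one_right] at hle
  omega

end S1

end PercRepro
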